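import Summits.CriticalPhenomena.Ising3DConformalLimit.Theses.FKParityRobustness
import Summits.CriticalPhenomena.Ising3DConformalLimit.Theorems.FKParityRobustnessIndependentStrandsJoinLimitDictionary
import Summits.CriticalPhenomena.Ising3DConformalLimit.Theorems.FKParityRobustnessIndependentStrandsJoinNonGaussianResidual
import Summits.CriticalPhenomena.Ising3DConformalLimit.Theorems.FKParityRobustnessIndependentStrandsJoinContinuumResidual
import Summits.CriticalPhenomena.Ising3DConformalLimit.Theorems.CanonicalBranchRefutationIsingLimitHeritage
import Literature.MathematicalPhysics.QuantumFieldTheory.PointwiseOSReconstruction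
import HarnessLib
import HarnessLib.Audit

/-!
# Skeleton — crux `IndependentStrandsJoin` (stmt-CriticalPhenomena-14625), ALTERNATIVE line `os-touching-rigidity`
# ("the tetrahedral residual, decoupled from the lattice: strict Lebowitz at the crossing-symmetric point for
#  reflection-positive Möbius-covariant families — the one language in which a tool (unitarity + crossing
#  extremality, Paulos–Zheng 2021) addresses propagation to the cross-ratio u = v = 1")

Route `FKParityRobustness`, sub-problem `Ising3DConformalLimit`.  Crux strategist
`planner-cstrat-stmt-CriticalPhenomena-14625-s1-0` (2026-08-17), registered as an ALTERNATIVE to the lead's live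
skeleton `pinch-to-tetra` r5 (never overwriting it).

Certified state of the crux (lead c2…c5, landed): modulo the route's own rank-4 crux `MoebiusLimit`
(item stmt-CriticalPhenomena-1344) the crux IS `NonGaussianLimit ∧ TNVᴹ`
(`independentStrandsJoin_iff_nonGaussian_and_tnvM`), where `TNVᴹ` = "every Möbius-covariant non-degenerate pointwise
limit `S` of `criticalCorr 3` with `U₄(S) ≢ 0` has `U₄(S)(y_tetra) < 0`" — a PROPAGATION-OF-ZEROS statement onto the
codimension-2 Möbius orbit of the regular tetrahedron (cross-ratios `u = v = 1`, the `S₃`-symmetric point; the same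
orbit contains the centred equilateral lattice triangle `{(0,0,0),(3,3,0),(3,0,3),(2,1,1)}` and "equilateral
triangle + ∞").  Nothing of Möbius / Lebowitz / Aizenman-bound / MMS type forces it (soft `GFF + bump` families
vanish exactly on that orbit), and reflection positivity reaches the orbit only OFF the diagonal of its Gram
matrices (census s1 §T11–T12, §N9).  The one mechanism known to control the value of a four-point function AT the
crossing-symmetric point is unitarity + crossing extremality: in unitary 3d CFT the correlator of identical scalars
is bounded above (gap `2Δ_φ`) by the generalised free field and the 3d Ising correlator MINIMISES it on the whole
Euclidean section (Paulos–Zheng, arXiv:2107.01215 §5; exact functionals on `z = z̄`, Paulos arXiv:2012.10454).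
Lebowitz (`U₄ ≤ 0`, inherited by every limit) is exactly pointwise domination by the GFF value; `TNV` says the
domination is STRICT at `u = v = 1` unless `U₄ ≡ 0`.

THE LINE types that statement for ABSTRACT families carrying only structure that every pointwise limit of
`criticalCorr 3` is PROVED to inherit (tree: `IsingLimitHeritage_of_stubs` — reflection positivity along the three
axes, GKS pairing bounds, Lebowitz; permutation symmetry on non-coincident configurations, proved below) plus what
item 1344 supplies (Möbius covariance, `Δ > 0`, `S₂ > 0`):
* `stub_moebiusLimit`     = item stmt-CriticalPhenomena-1344 VERBATIM (shared; consumed by `closes` anyway);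
* `stub_nonGaussianLimit` = item stmt-CriticalPhenomena-0636 VERBATIM (shared; clause (iii));
* `stub_touchingRigidity` (NEW, the line's one crux-specific statement, NO lattice object): for every `Δ > 0` and every
  Möbius-covariant, non-degenerate, axis-reflection-positive, permutation-symmetric `S : CorrFamily 3` obeying the GKS
  pairing bounds and Lebowitz `U₄ ≤ 0` on non-coincident quadruples, `U₄ ≢ 0 ⟹ U₄(y_tetra) < 0`.
Composition (`IndependentStrandsJoin_of`, sorry-free): 1344 gives `(ρ, Δ, S)`; heritage + the permutation lemma feed
`stub_touchingRigidity`; 0636 gives `U₄(S) ≢ 0`; so `U₄(S)(y_tetra) < 0`, and the landed dictionary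
`independentStrandsJoin_iff_limitU4_tetra_neg` (limit upgrade + per-scale truth + per-box sandwich) returns the crux
BY NAME.  Calibration: the crux implies `stub_nonGaussianLimit` (closed bridge) and the INSTANCE of
`stub_touchingRigidity` at Ising limits (`tnvM_of_independentStrandsJoin`); the abstract stub is stronger than that
instance by design (strengthen lens: fewer usable hypotheses, a tool-bearing language).

Disproof used: § A (per-scale truth, inside the landed dictionary), § B (entered through the landed sandwich), § A′
(complied: no graph-uniform constant), § D (every content-bearing stub fails for `d ≥ 4`/long-range: there the limit
is Gaussian and `stub_nonGaussianLimit` is false; `stub_touchingRigidity` is dimension-free and claimed as such — its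
hypotheses hold for GFFs, where its conclusion is vacuous).  No `_false_without_` theorem exists for this crux.
-/

noncomputable section

open Filter Topology
open Literature.Probability.LatticeModels
open Literature.MathematicalPhysics.QuantumFieldTheory (IsReflectionPositiveAlong)
open Summit.CriticalPhenomena.Ising3DConformalLimit.Theses.FKParityRobustness
open Summit.CriticalPhenomena.Ising3DConformalLimit.Cruxes.IndependentStrandsJoin.PinchToTetra
  (yTetra independentStrandsJoin_iff_limitU4_tetra_neg tnvM_of_independentStrandsJoin)
open Summit.CriticalPhenomena.Ising3DConformalLimit.FKParityRobustnessJoinForcesU4 (joinForcesU4_proof)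

namespace Summit.CriticalPhenomena.Ising3DConformalLimit.Cruxes.IndependentStrandsJoin.OsTouchingRigidity

/-! ## The abstract structure and the one new statement -/

/-- Permutation symmetry of a correlation family ON NON-COINCIDENT configurations (axiom (E3) where the
pointwise limit is defined; no normalisation off the diagonals is asked). -/
def IsPermSymmetricOnNonCoincident (S : CorrFamily 3) : Prop :=
  ∀ (n : ℕ) (σ : Equiv.Perm (Fin n)) (x : Fin n → EuclideanSpace ℝ (Fin 3)),
    x ∈ NonCoincident 3 n → S n (x ∘ σ) = S n x

/-- GKS-II pairing bounds `S₂S₂ ≤ S₄` for the three pairings of a non-coincident quadruple. -/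
def HasGKSPairings (S : CorrFamily 3) : Prop :=
  ∀ x ∈ NonCoincident 3 4,
    S 2 ![x 0, x 1] * S 2 ![x 2, x 3] ≤ S 4 x ∧ S 2 ![x 0, x 2] * S 2 ![x 1, x 3] ≤ S 4 x ∧
      S 2 ![x 0, x 3] * S 2 ![x 1, x 2] ≤ S 4 x

/-- Lebowitz' inequality `U₄ ≤ 0` on non-coincident quadruples (pointwise domination by the GFF/Wick value). -/
def HasLebowitz (S : CorrFamily 3) : Prop :=
  ∀ x ∈ NonCoincident 3 4, limitConnectedFour S x ≤ 0

/-- **`TouchingRigidity`** — the line's new statement (abstract, lattice-free): for a Möbius-covariant (`Δ > 0`),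
non-degenerate, axis-reflection-positive, permutation-symmetric family with GKS pairings and Lebowitz, a connected
four-point function that is not identically zero is STRICTLY negative at the regular tetrahedron (equivalently, by
covariance, on the whole cross-ratio orbit `u = v = 1`). -/
def TouchingRigidity : Prop :=
  ∀ (Δ : ℝ) (S : CorrFamily 3), 0 < Δ → IsMoebiusCovariant Δ S → IsNondegenerateTwoPoint S →
    (∀ τ : Fin 3, IsReflectionPositiveAlong τ S) → IsPermSymmetricOnNonCoincident S →
    HasGKSPairings S → HasLebowitz S → HasNontrivialU4 S → limitConnectedFour S yTetra < 0

/-! ### Name-keyed aliases of the registered stubs -/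
namespace Registered
/-- = route item stmt-CriticalPhenomena-1344 (`MoebiusLimit`), keyed by the stub name. -/
abbrev stub_moebiusLimit : Prop := MoebiusLimit
/-- = route item stmt-CriticalPhenomena-0636 (`NonGaussianLimit`), keyed by the stub name. -/
abbrev stub_nonGaussianLimit : Prop := NonGaussianLimit
/-- = `TouchingRigidity`, keyed by the stub name. -/
abbrev stub_touchingRigidity : Prop := TouchingRigidity
end Registered

/-! ## Registered stubs (`sorry` lives ONLY here) -/

/-- **stub_moebiusLimit** = item stmt-CriticalPhenomena-1344 VERBATIM (the route's rank-4 crux, a binder of `closes`;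
SHARED, owned by the covariance routes; not attacked here). -/
theorem stub_moebiusLimit :
    ∃ (ρ : ℝ → ℝ) (Δ : ℝ) (S : CorrFamily 3), (∀ δ ∈ Set.Ioc (0:ℝ) 1, 0 < ρ δ) ∧ 0 < Δ ∧
      HasPointwiseScalingLimit (criticalCorr 3) ρ S ∧ IsNondegenerateTwoPoint S ∧ IsMoebiusCovariant Δ S := by
  sorry

/-- **stub_nonGaussianLimit** = item stmt-CriticalPhenomena-0636 VERBATIM (clause (iii); SHARED; implied by the
crux through the closed bridge `JoinForcesU4`). -/
theorem stub_nonGaussianLimit :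
    ∀ (ρ : ℝ → ℝ) (S : CorrFamily 3), (∀ δ ∈ Set.Ioc (0:ℝ) 1, 0 < ρ δ) →
      HasPointwiseScalingLimit (criticalCorr 3) ρ S → IsNondegenerateTwoPoint S → HasNontrivialU4 S := by
  sorry

/-- **stub_touchingRigidity** — the NEW statement (see `TouchingRigidity`): strict Lebowitz at the crossing-symmetric
point for reflection-positive Möbius-covariant families.  Open; the language is that of exact/numerical correlator
bounds (Paulos arXiv:2012.10454; Paulos–Zheng arXiv:2107.01215): `TouchingRigidity` says the generalised free field
is the ONLY such family realising its own value `G(u=v=1) = 3·S₂S₂` among Lebowitz-dominated ones. -/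
theorem stub_touchingRigidity :
    ∀ (Δ : ℝ) (S : CorrFamily 3), 0 < Δ → IsMoebiusCovariant Δ S → IsNondegenerateTwoPoint S →
      (∀ τ : Fin 3, IsReflectionPositiveAlong τ S) →
      (∀ (n : ℕ) (σ : Equiv.Perm (Fin n)) (x : Fin n → EuclideanSpace ℝ (Fin 3)),
        x ∈ NonCoincident 3 n → S n (x ∘ σ) = S n x) →
      (∀ x ∈ NonCoincident 3 4,
        S 2 ![x 0, x 1] * S 2 ![x 2, x 3] ≤ S 4 x ∧ S 2 ![x 0, x 2] * S 2 ![x 1, x 3] ≤ S 4 x ∧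
          S 2 ![x 0, x 3] * S 2 ![x 1, x 2] ≤ S 4 x) →
      (∀ x ∈ NonCoincident 3 4, limitConnectedFour S x ≤ 0) →
      HasNontrivialU4 S → limitConnectedFour S yTetra < 0 := by
  sorry

/-! ## Inherited structure of Ising limits (PROVED; no `sorry`) -/

/-- The critical correlators are symmetric functions of the sites (relabelling does not change the spin monomial). -/
theorem criticalCorr_comp_perm {n : ℕ} (σ : Equiv.Perm (Fin n)) (k : Fin n → Site 3) :
    criticalCorr 3 n (k ∘ σ) = criticalCorr 3 n k := by
  have h : spinMonomial (k ∘ σ) = spinMonomial k := by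
    funext s
    simp only [spinMonomial, Function.comp_apply]
    exact Equiv.prod_comp σ (fun i => spinAt (k i) s)
  show plusExpect 3 (criticalBeta 3) 0 (spinMonomial (k ∘ σ)) = plusExpect 3 (criticalBeta 3) 0 (spinMonomial k)
  rw [h]

/-- **Permutation symmetry (E3) on non-coincident configurations is inherited by every pointwise scaling limit of
`criticalCorr 3`**: at every mesh the rescaled correlators at `x ∘ σ` and at `x` coincide, so their limits agree. -/
theorem isPermSymmetricOnNonCoincident_of_limit {ρ : ℝ → ℝ} {S : CorrFamily 3}
    (hlim : HasPointwiseScalingLimit (criticalCorr 3) ρ S) : IsPermSymmetricOnNonCoincident S := by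
  intro n σ x hx
  have hxσ : (x ∘ σ) ∈ NonCoincident 3 n := (show Function.Injective x from hx).comp σ.injective
  have h1 := (hlim n).tendsto_at hxσ
  have h2 := (hlim n).tendsto_at hx
  refine tendsto_nhds_unique (h1.congr fun δ => ?_) h2
  simp only [rescaledCorrelator_apply, Function.comp_apply]
  exact congrArg _ (criticalCorr_comp_perm σ fun i => latticeApprox δ (x i))

/-- **Every Möbius-covariant pointwise limit of `criticalCorr 3` satisfies the hypotheses of `TouchingRigidity`**
(heritage: `IsingLimitHeritage_of_stubs` of route `CanonicalBranchRefutation` — axis RP, GKS pairings, Lebowitz —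
and the permutation lemma), hence `TouchingRigidity ⟹ TNVᴹ`. -/
theorem tnvM_of_touchingRigidity (hTR : TouchingRigidity) :
    ∀ (ρ : ℝ → ℝ) (Δ : ℝ) (S : CorrFamily 3), (∀ δ ∈ Set.Ioc (0:ℝ) 1, 0 < ρ δ) → 0 < Δ →
      HasPointwiseScalingLimit (criticalCorr 3) ρ S → IsNondegenerateTwoPoint S → IsMoebiusCovariant Δ S →
      HasNontrivialU4 S → limitConnectedFour S yTetra < 0 := by
  intro ρ Δ S hρ hΔ hlim hnd hmob hU
  obtain ⟨hRP, hGKS, hLeb⟩ :=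
    Summit.CriticalPhenomena.Ising3DConformalLimit.Cruxes.IsingLimitHeritage.Birth.IsingLimitHeritage_of_stubs
      ρ S hρ hlim
  exact hTR Δ S hΔ hmob hnd hRP (isPermSymmetricOnNonCoincident_of_limit hlim) hGKS hLeb hU

/-! ## Composition: the crux BY NAME from exactly the three registered stubs -/

/-- **The line's composition**: item 1344 posits `(ρ, Δ, S)`; the inherited OS-type structure and
`stub_touchingRigidity` give `U₄(S)(y_tetra) < 0` once `U₄(S) ≢ 0` (item 0636); the landed dictionary
`independentStrandsJoin_iff_limitU4_tetra_neg` returns the lattice crux. -/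
theorem IndependentStrandsJoin_of (h1 : Registered.stub_moebiusLimit) (h2 : Registered.stub_nonGaussianLimit)
    (h3 : Registered.stub_touchingRigidity) :
    Summit.CriticalPhenomena.Ising3DConformalLimit.Theses.FKParityRobustness.IndependentStrandsJoin := by
  obtain ⟨ρ, Δ, S, hρ, hΔ, hlim, hnd, hmob⟩ := h1
  exact (independentStrandsJoin_iff_limitU4_tetra_neg hρ hlim hnd).2
    (tnvM_of_touchingRigidity h3 ρ Δ S hρ hΔ hlim hnd hmob (h2 ρ S hρ hlim hnd))

/-! ### Consistency: each registered stub IS its alias, and the wiring -/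
example : Registered.stub_moebiusLimit := stub_moebiusLimit
example : Registered.stub_nonGaussianLimit := stub_nonGaussianLimit
example : Registered.stub_touchingRigidity := stub_touchingRigidity
example : Summit.CriticalPhenomena.Ising3DConformalLimit.Theses.FKParityRobustness.IndependentStrandsJoin :=
  IndependentStrandsJoin_of stub_moebiusLimit stub_nonGaussianLimit stub_touchingRigidity

/-! ### Calibration (no crux-side stub overshoots the crux at Ising limits) -/

/-- The crux implies `stub_nonGaussianLimit` outright (closed bridge `JoinForcesU4`). -/
example (h : IndependentStrandsJoin) : Registered.stub_nonGaussianLimit := joinForcesU4_proof h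

/-- The crux implies the INSTANCE of `stub_touchingRigidity` at Möbius-covariant Ising limits (`TNVᴹ`, landed
`tnvM_of_independentStrandsJoin`): the abstract stub is a strengthening of exactly the crux's residual. -/
example (h : IndependentStrandsJoin) :
    ∀ (ρ : ℝ → ℝ) (Δ : ℝ) (S : CorrFamily 3), (∀ δ ∈ Set.Ioc (0:ℝ) 1, 0 < ρ δ) →
      HasPointwiseScalingLimit (criticalCorr 3) ρ S → IsNondegenerateTwoPoint S → IsMoebiusCovariant Δ S →
      HasNontrivialU4 S → limitConnectedFour S yTetra < 0 :=
  tnvM_of_independentStrandsJoin h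

/-- `TouchingRigidity` is vacuous-true on Gaussian families (`U₄ ≡ 0` contradicts `HasNontrivialU4`): its content is
exactly the non-Gaussian, reflection-positive case. -/
example (S : CorrFamily 3) (hG : ∀ x ∈ NonCoincident 3 4, limitConnectedFour S x = 0)
    (hU : HasNontrivialU4 S) : limitConnectedFour S yTetra < 0 := by
  obtain ⟨x, hx, hne⟩ := hU
  exact absurd (hG x hx) hne

end Summit.CriticalPhenomena.Ising3DConformalLimit.Cruxes.IndependentStrandsJoin.OsTouchingRigidity
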